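import Summits.KontsevichZagierPeriods.KontsevichZagierPeriods.Theorems.LinRedNormalFormArrangementNormalFormStubRebaseSimplePosOnePosParDual
import Summits.KontsevichZagierPeriods.KontsevichZagierPeriods.Theorems.LinRedNormalFormArrangementNormalFormStubRebaseSimplePosOnePosFlats

/-!
# Stub `stub_rebaseSimplePosOnePos` (crux `ArrangementNormalForm`, line `janus-bands`) —
part `ParTripleTools`: cutting product cells, and the NEAR-SIDE configuration (B2) in full

Tools for the reduction of the residual hypothesis `HparFlat` (parallel transverse bands over a
product cell `{x'-rows M₀} × (ylo(x'), yhi(x'))` whose closed cell meets the flat `{h = 0 = w}`,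
`h = yhi − ylo`, `w = v − u`; part `Flats`) to TRIPLE points (part `ParTriple`), any base
dimension `B + 1`:
* `RebasePos.liftX` — an `x'`-form read as a `y`-free full-base form, and `RebasePos.cutCell` —
  rule (1a): cutting a product cell by an `x'`-form `g ≠ 0` gives two product cells with the
  same `y`-bounds and the extra `x'`-row `±g` (`RebasePos.cutBase` plus the bookkeeping of
  `hsec`);
* `RebasePos.good_parCell_nearSide` — **configuration (B2) is closed, flat or not**: if the base
  pole `ℓ₂(x')` lies on the NEAR side of the `y`-range (`yhi ≤ ℓ₂` when the common slope `s` of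
  the bounds is positive, `ℓ₂ ≤ ylo` when it is negative), then after the shear `t' = t − u` the
  partial fractions in `y` are dominated with constant `C = 1` (`t > 0` and `−s (y − ℓ₂) > 0`
  have the same sign, so `t − s (y − ℓ₂)` dominates both). Cut the `x'`-cell by the rational
  hyperplane `w = |s| h` (rule 1a, `cutCell`): where `|s| h ≤ w` ONE level split closes the band
  (`RebasePos.good_parLevel`, `N = 0`); where `w < |s| h` the swapped band of
  `RebasePos.good_parDominated` (part `ParDual`) satisfies the dual inequality
  `|s|⁻¹ w ≤ h` and is closed by one level split as well. No compactness, no residue.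
Registered as `rebaseSimplePos_par_nearSide`.

References: M. Kontsevich, D. Zagier, *Periods* (2001), §1.2, rules (1a), (1b), (2).
-/

noncomputable section

open Set MeasureTheory MvPolynomial
open Literature.NumberTheory.Transcendental Literature.ModelTheory.ExponentialFields

namespace Summit.KontsevichZagierPeriods.ArrangementNormalForm.JanusBands

namespace RebasePos

open SeparatePos

section LiftX

variable {B : ℕ}

/-- An `x'`-form `g` read as the `y`-free full-base form `(snoc g' 0, g₀)`. -/
def liftX (g : (Fin B → ℚ) × ℚ) : (Fin (B + 1) → ℚ) × ℚ :=
  ((Fin.snoc g.1 0 : Fin (B + 1) → ℚ), g.2)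

/-- `liftX g` evaluates to `g`. -/
@[simp] theorem affF_liftX (g : (Fin B → ℚ) × ℚ) (z : Fin (B + 1 + 1) → ℝ) :
    affF B 1 (liftX g) z = affB B 1 g z :=
  affF_liftB g z

/-- `liftX g ≠ 0` for `g ≠ 0`. -/
theorem liftX_ne_zero {g : (Fin B → ℚ) × ℚ} (hg : g ≠ 0) : liftX g ≠ 0 :=
  liftB_ne_zero hg

/-- `liftX g` is `y`-free. -/
@[simp] theorem liftX_last (g : (Fin B → ℚ) × ℚ) : (liftX g).1 (Fin.last B) = 0 := by
  simp [liftX]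

end LiftX

section Cut

variable {B m' m₀ : ℕ}

/-- **Cutting a product cell by an `x'`-form** (rule 1a). The two pieces of the cut of the
product cell `{x'-rows M₀} × (ylo, yhi)` (literal rows `M`, `hsec`) by `g ≠ 0` are again product
cells with the same `y`-bounds, literal rows `snoc M (liftX g)` resp. `snoc M (−liftX g)` and
`x'`-rows `snoc M₀ g` resp. `snoc M₀ (−g)`; they carry the same integrand, are contained in the
original domain, and `[s] − [s₁] − [s₂] ∈ KZ.relations`. -/
theorem cutCell (s : KZ.IntegralRep (B + 1 + 1)) (M : Fin m' → (Fin (B + 1) → ℚ) × ℚ)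
    (M₀ : Fin m₀ → (Fin B → ℚ) × ℚ) (ylo yhi : (Fin B → ℚ) × ℚ) (u v : (Fin (B + 1) → ℚ) × ℚ)
    (hdom : s.domain = gDom B 1 m' M (fun _ => Sum.inr u) (fun _ => Sum.inr v))
    (hsec : ∀ z : Fin (B + 1 + 1) → ℝ, (∀ j, 0 < affF B 1 (M j) z) ↔ ((∀ j, 0 < affB B 1 (M₀ j) z) ∧
      affB B 1 ylo z < z (Fin.castAdd 1 (Fin.last B)) ∧ z (Fin.castAdd 1 (Fin.last B)) < affB B 1 yhi z))
    (g : (Fin B → ℚ) × ℚ) (hg : g ≠ 0) :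
    ∃ s₁ s₂ : KZ.IntegralRep (B + 1 + 1),
      s₁.domain ⊆ s.domain ∧ s₂.domain ⊆ s.domain ∧
      s₁.integrand = s.integrand ∧ s₂.integrand = s.integrand ∧
      s₁.domain = gDom B 1 (m' + 1) (Fin.snoc M (liftX g)) (fun _ => Sum.inr u) (fun _ => Sum.inr v) ∧
      s₂.domain = gDom B 1 (m' + 1) (Fin.snoc M (-liftX g)) (fun _ => Sum.inr u) (fun _ => Sum.inr v) ∧
      (∀ z : Fin (B + 1 + 1) → ℝ, (∀ j, 0 < affF B 1 ((Fin.snoc M (liftX g) : Fin (m' + 1) → _) j) z) ↔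
        ((∀ j, 0 < affB B 1 ((Fin.snoc M₀ g : Fin (m₀ + 1) → _) j) z) ∧
          affB B 1 ylo z < z (Fin.castAdd 1 (Fin.last B)) ∧ z (Fin.castAdd 1 (Fin.last B)) < affB B 1 yhi z)) ∧
      (∀ z : Fin (B + 1 + 1) → ℝ, (∀ j, 0 < affF B 1 ((Fin.snoc M (-liftX g) : Fin (m' + 1) → _) j) z) ↔
        ((∀ j, 0 < affB B 1 ((Fin.snoc M₀ (-g) : Fin (m₀ + 1) → _) j) z) ∧
          affB B 1 ylo z < z (Fin.castAdd 1 (Fin.last B)) ∧ z (Fin.castAdd 1 (Fin.last B)) < affB B 1 yhi z)) ∧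
      KZ.of s - KZ.of s₁ - KZ.of s₂ ∈ KZ.relations := by
  obtain ⟨s₁, s₂, hm₁, hm₂, hi₁, hi₂, hd₁, hd₂, hrel⟩ := cutBase s M _ _ hdom (liftX g) (liftX_ne_zero hg)
  refine ⟨s₁, s₂, fun z hz => ((hm₁ z).1 hz).1, fun z hz => ((hm₂ z).1 hz).1, hi₁, hi₂, hd₁, hd₂,
    fun z => ?_, fun z => ?_, hrel⟩
  · rw [rowsF_snoc_iff, rowsB_snoc_iff, hsec, affF_liftX]
    tauto
  · rw [rowsF_snoc_iff, rowsB_snoc_iff, hsec, affF_neg', affF_liftX, affB_neg']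
    tauto

end Cut

section NearSide

variable {B m m' m₀ : ℕ} (L : Fin m → (Fin B → ℚ) × ℚ) (e : Fin m → ℕ) (ℓ₁ ℓ₂ : (Fin B → ℚ) × ℚ)

/-- The level form `g = w − |s| h` of a parallel band over a product cell: `w = v − u` the
(`y`-free) width, `h = yhi − ylo` the height, `s` the common slope. -/
theorem affB_levelForm (ylo yhi : (Fin B → ℚ) × ℚ) (u v : (Fin (B + 1) → ℚ) × ℚ)
    (hpar : u.1 (Fin.last B) = v.1 (Fin.last B)) (z : Fin (B + 1 + 1) → ℝ) :
    affB B 1 ((restr B v - restr B u) - |u.1 (Fin.last B)| • (yhi - ylo)) z =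
      (affF B 1 v z - affF B 1 u z) - |(u.1 (Fin.last B) : ℝ)| * (affB B 1 yhi z - affB B 1 ylo z) := by
  rw [affB_sub, affB_smul', affB_sub, ← width_eq u v hpar z, affB_sub, Rat.cast_abs]

/-- **Configuration (B2) over a product cell is closed.** The data of `Hpar` over a product cell
(`hsec`) with non-degenerate `y`-range (`hne`) and the base pole on the NEAR side of the
`y`-range (`hside`: `yhi ≤ ℓ₂` if `s > 0`, `ℓ₂ ≤ ylo` if `s < 0`): `[s]` is congruent modulo
`KZ.relations` to the subgroup generated by `GG B 2 1`. See the module docstring. -/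
theorem good_parCell_nearSide (s : KZ.IntegralRep (B + 1 + 1)) (M : Fin m' → (Fin (B + 1) → ℚ) × ℚ)
    (M₀ : Fin m₀ → (Fin B → ℚ) × ℚ) (ylo yhi : (Fin B → ℚ) × ℚ) (p : MvPolynomial (Fin B) ℚ)
    (u v : (Fin (B + 1) → ℚ) × ℚ) (hbd : Bornology.IsBounded s.domain)
    (hdom : s.domain = gDom B 1 m' M (fun _ => Sum.inr u) (fun _ => Sum.inr v))
    (hint : EqOn s.integrand (glit B 1 p L e ℓ₁ ℓ₂ 0 1 (fun _ => some 0)) s.domain)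
    (hu : u.1 (Fin.last B) ≠ 0) (hpar : u.1 (Fin.last B) = v.1 (Fin.last B))
    (hcell : ∀ z : Fin (B + 1 + 1) → ℝ, (∀ j, 0 < affF B 1 (M j) z) → 0 < affF B 1 u z ∧ affF B 1 u z < affF B 1 v z)
    (hsec : ∀ z : Fin (B + 1 + 1) → ℝ, (∀ j, 0 < affF B 1 (M j) z) ↔ ((∀ j, 0 < affB B 1 (M₀ j) z) ∧
      affB B 1 ylo z < z (Fin.castAdd 1 (Fin.last B)) ∧ z (Fin.castAdd 1 (Fin.last B)) < affB B 1 yhi z))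
    (hne : ∀ z : Fin (B + 1 + 1) → ℝ, (∀ j, 0 < affB B 1 (M₀ j) z) → affB B 1 ylo z < affB B 1 yhi z)
    (hside : ∀ z : Fin (B + 1 + 1) → ℝ, (∀ j, 0 < affB B 1 (M₀ j) z) →
      (0 < u.1 (Fin.last B) → affB B 1 yhi z ≤ affB B 1 ℓ₂ z) ∧ (u.1 (Fin.last B) < 0 → affB B 1 ℓ₂ z ≤ affB B 1 ylo z)) :
    ∃ c ∈ AddSubgroup.closure (GGset B 2 1), KZ.of s - c ∈ KZ.relations := by
  set sq : ℚ := u.1 (Fin.last B) with hsq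
  have hpole : ∀ z : Fin (B + 1 + 1) → ℝ, (∀ j, 0 < affB B 1 (M₀ j) z) →
      affB B 1 ℓ₂ z ≤ affB B 1 ylo z ∨ affB B 1 yhi z ≤ affB B 1 ℓ₂ z := fun z hz => by
    rcases lt_or_gt_of_ne hu with hn | hp
    · exact Or.inl ((hside z hz).2 hn)
    · exact Or.inr ((hside z hz).1 hp)
  have hs0 : 0 < |(sq : ℝ)| := abs_pos.2 (by rw [hsq]; exact_mod_cast hu)
  -- domination with constant `1`
  have hdomC : ∀ z : Fin (B + 1 + 1) → ℝ, (∀ j, 0 < affF B 1 (M j) z) → ∀ T : ℝ, affF B 1 u z < T →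
      T < affF B 1 v z →
      |T| ≤ 1 * |T - (u.1 (Fin.last B) : ℝ) * (z (Fin.castAdd 1 (Fin.last B)) - affB B 1 ℓ₂ z)| ∧
      |(u.1 (Fin.last B) : ℝ) * (z (Fin.castAdd 1 (Fin.last B)) - affB B 1 ℓ₂ z)| ≤
        1 * |T - (u.1 (Fin.last B) : ℝ) * (z (Fin.castAdd 1 (Fin.last B)) - affB B 1 ℓ₂ z)| := by
    intro z hz T hT1 _hT2
    obtain ⟨h0, hlo, hhi⟩ := (hsec z).1 hz
    have hTpos : 0 < T := lt_trans (hcell z hz).1 hT1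
    have hneg : (u.1 (Fin.last B) : ℝ) * (z (Fin.castAdd 1 (Fin.last B)) - affB B 1 ℓ₂ z) ≤ 0 := by
      rcases lt_or_gt_of_ne hu with hn | hp
      · have h1 := (hside z h0).2 hn
        have hn' : (u.1 (Fin.last B) : ℝ) < 0 := by exact_mod_cast hn
        exact mul_nonpos_iff.2 (Or.inr ⟨hn'.le, by linarith⟩)
      · have h1 := (hside z h0).1 hp
        have hp' : (0 : ℝ) < u.1 (Fin.last B) := by exact_mod_cast hp
        exact mul_nonpos_iff.2 (Or.inl ⟨hp'.le, by linarith⟩)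
    rw [one_mul, abs_of_pos hTpos, abs_of_nonpos hneg, abs_of_pos (by linarith)]
    exact ⟨by linarith, by linarith⟩
  -- the level form `g = w − |s| h`
  set g : (Fin B → ℚ) × ℚ := (restr B v - restr B u) - |sq| • (yhi - ylo) with hg
  have hgz : ∀ z : Fin (B + 1 + 1) → ℝ, affB B 1 g z =
      (affF B 1 v z - affF B 1 u z) - |(sq : ℝ)| * (affB B 1 yhi z - affB B 1 ylo z) := fun z => by
    rw [hg, hsq, affB_levelForm ylo yhi u v hpar z]
  by_cases hg0 : g = 0
  · -- `w = |s| h` identically: one level split on the whole cell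
    refine good_parLevel L e ℓ₁ ℓ₂ 0 1 M₀ yhi p u v (Or.inl rfl) hpar 0 s M ylo hbd hdom hint
      (fun z hz => (hsec z).1 hz) fun z _ => ?_
    have h := hgz z
    rw [hg0, affB_zeroYT] at h
    rw [Nat.cast_zero, zero_add, one_mul, ← hsq]
    linarith
  obtain ⟨s₁, s₂, hsub₁, hsub₂, hi₁, hi₂, hd₁, hd₂, hsec₁, hsec₂, hrel⟩ :=
    cutCell s M M₀ ylo yhi u v hdom hsec g hg0
  refine good_of_split hrel ?_ ?_
  · -- `w > |s| h`: one level split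
    refine good_parLevel L e ℓ₁ ℓ₂ 0 1 (Fin.snoc M₀ g) yhi p u v (Or.inl rfl) hpar 0 s₁ _ ylo (hbd.subset hsub₁)
      hd₁ (by rw [hi₁]; exact hint.mono hsub₁) (fun z hz => (hsec₁ z).1 hz) fun z hz => ?_
    obtain ⟨⟨-, hgp⟩, -, -⟩ := (hsec₁ z).1 hz |>.imp_left rowsB_snoc_iff.1
    rw [hgz] at hgp
    rw [Nat.cast_zero, zero_add, one_mul, ← hsq]
    linarith
  · -- `w < |s| h`: dominated partial fractions, dual level split
    refine good_parDominated L e ℓ₁ ℓ₂ s₂ _ (Fin.snoc M₀ (-g)) ylo yhi p u v (hbd.subset hsub₂) hd₂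
      (by rw [hi₂]; exact hint.mono hsub₂) hu hpar (fun z hz => hcell z (rows_snoc hz).1) hsec₂
      (fun z hz => hne z (rowsB_snoc_iff.1 hz).1) (fun z hz => hpole z (rowsB_snoc_iff.1 hz).1) 1
      (fun z hz => hdomC z (rows_snoc hz).1) (Or.inr ⟨0, fun z hz => ?_⟩)
    have hgn := (rowsB_snoc_iff.1 hz).2
    rw [affB_neg', hgz] at hgn
    rw [Nat.cast_zero, zero_add, one_mul, ← hsq, inv_mul_le_iff₀ hs0]
    linarith

end NearSide

end RebasePos

/-- **Registered part of `stub_rebaseSimplePosOnePos`, residual hypothesis `Hpar` (line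
`janus-bands`): configuration (B2) over a product cell is closed, flat or not.** The data of
`Hpar` (one lettered fibre over a bounded base cell in `ℝ^{B+1}`, letter `0`, affine bounds
`0 < u < v` parallel in `y` with common slope `s ≠ 0`, base pole `1/(y − ℓ₂(x'))`) over a
product cell `{x'-rows M₀} × (ylo, yhi)` (`hsec`) with non-degenerate `y`-range, the pole on the
NEAR side (`yhi ≤ ℓ₂` if `s > 0`, `ℓ₂ ≤ ylo` if `s < 0`): `[s] ∈ closure (GG B 2 1)` modulo
`KZ.relations` — cut by `w = |s| h` (rule 1a); `|s| h ≤ w`: one level split; `w < |s| h`: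
dominated partial fractions with `C = 1` and one dual level split (`rebaseSimplePos_par_dominated`). -/
theorem rebaseSimplePos_par_nearSide (B m m' m₀ : ℕ) (s : KZ.IntegralRep (B + 1 + 1)) (M : Fin m' → (Fin (B + 1) → ℚ) × ℚ) (M₀ : Fin m₀ → (Fin B → ℚ) × ℚ) (ylo yhi : (Fin B → ℚ) × ℚ) (L : Fin m → (Fin B → ℚ) × ℚ) (e : Fin m → ℕ) (p : MvPolynomial (Fin B) ℚ) (ℓ₁ ℓ₂ : (Fin B → ℚ) × ℚ) (u v : (Fin (B + 1) → ℚ) × ℚ) (hbd : Bornology.IsBounded s.domain) (hdom : s.domain = SeparatePos.gDom B 1 m' M (fun _ => Sum.inr u) (fun _ => Sum.inr v)) (hint : Set.EqOn s.integrand (RebasePos.glit B 1 p L e ℓ₁ ℓ₂ 0 1 (fun _ => some 0)) s.domain) (hu : u.1 (Fin.last B) ≠ 0) (hpar : u.1 (Fin.last B) = v.1 (Fin.last B)) (hcell : ∀ z : Fin (B + 1 + 1) → ℝ, (∀ j, 0 < SeparatePos.affF B 1 (M j) z) → 0 < SeparatePos.affF B 1 u z ∧ SeparatePos.affF B 1 u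 z < SeparatePos.affF B 1 v z) (hsec : ∀ z : Fin (B + 1 + 1) → ℝ, (∀ j, 0 < SeparatePos.affF B 1 (M j) z) ↔ ((∀ j, 0 < SeparatePos.affB B 1 (M₀ j) z) ∧ SeparatePos.affB B 1 ylo z < z (Fin.castAdd 1 (Fin.last B)) ∧ z (Fin.castAdd 1 (Fin.last B)) < SeparatePos.affB B 1 yhi z)) (hne : ∀ z : Fin (B + 1 + 1) → ℝ, (∀ j, 0 < SeparatePos.affB B 1 (M₀ j) z) → SeparatePos.affB B 1 ylo z < SeparatePos.affB B 1 yhi z) (hside : ∀ z : Fin (B + 1 + 1) → ℝ, (∀ j, 0 < SeparatePos.affB B 1 (M₀ j) z) → (0 < u.1 (Fin.last B) → SeparatePos.affB B 1 yhi z ≤ SeparatePos.affB B 1 ℓ₂ z) ∧ (u.1 (Fin.last B) < 0 → SeparatePos.affB B 1 ℓ₂ z ≤ SeparatePos.affB B 1 ylo z)) : ∃ c ∈ AddSubgroup.closure (SeparatePos.GGset B 2 1), KZ.of s - c ∈ KZ.relations :=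
  RebasePos.good_parCell_nearSide L e ℓ₁ ℓ₂ s M M₀ ylo yhi p u v hbd hdom hint hu hpar hcell hsec hne hside

end Summit.KontsevichZagierPeriods.ArrangementNormalForm.JanusBands
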